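import Summits.FinalStateConjecture.FinalStateConjecture.Theorems.BartnikGapSettlingCaptureStubPhantomSuccAux
import HarnessLib

/-!
# Stub `stub_hypRadius` of line `Sketch` of crux `Capture` (stmt-FinalStateConjecture-10115):
# every boosted Kerr–Schild radius is attained on the unit hyperboloid

Crux `Capture` (routes `BartnikGapSettling` / `QuietWindowCapture`, summit `FinalStateConjecture`),
line `Sketch`, lead `prover-line-stmt-FinalStateConjecture-10115-c3-0` (cycle 4), skeleton v7
(`Cruxes/Capture/Lines/Sketch.lean`, §7b).  The re-typing specification of the skeleton (§7,
`IsHonestNearKerrLeaf`: slab-to-slab overlaps + flat-frame separation) kills the PHANTOM labels of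
the typed leaf predicate (`stub_phantomSucc`, p111332) through ONE piece of `E4`-geometry, proved
here as the registered stub `stub_hypRadius`:

for every motion `(Λ, c)`, spin `a` and radius `t > 0` there is a point `x` of the unit hyperboloid
`{x⁰ − √(1 + |x̲|²) = 0}` whose boosted Kerr–Schild radius `r_a(Λ⁻¹(x − c))` is exactly `t`.

Hence the flat annulus `{t₀ = 0, ρᵢ < rᵢ < Rᵢ}` of every label of a leaf is NON-EMPTY, and an
overlap clause charting it by the certified Kerr disc `{t*ᵢ = 0, Mᵢ < rᵢ ≤ Rᵢ}` forces `Mᵢ < Rᵢ`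
(skeleton §7b, `IsHonestNearKerrLeaf.real_hole`).

Proof.  (1) The straight time-like world-line `s ↦ c + s Λe₀` crosses the hyperboloid: along it the
hyperboloidal time `t₀` is continuous with `c⁰ + sγ − 1 − |c̲| − |s|σ ≤ t₀ ≤ c⁰ + sγ − 1`,
`γ = (Λe₀)⁰`, `σ = |(Λe₀)~|`, `γ² = 1 + σ²` (`lorentz_apply_zero_sq`), so `2(γ² − |γ|σ) ≥ 1` and `t₀`
changes sign between `s = −(|c⁰| + 2)γ` and `s = 2(|c⁰| + |c̲| + 1)γ` (IVT on `ℝ`).  On the world-line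
`r = r_a(s e₀) = 0`.  (2) Far out on the hyperboloid `r > t`: the tube `{r ≤ t}` meets the
hyperboloidal layer in a bounded set (`stub_phantomSuccTube`, p110726) while the hyperboloid
contains `(√(1 + L²), L, 0, 0)` of norm `> L`.  (3) IVT on the connected `E4` for
`x ↦ r_a(Λ⁻¹(π(x) − c))`, `π` the vertical projection onto the hyperboloid.

References: O'Neill 1983, Ch. 9, p. 233 (unit time-like vectors of `O(1,3)`); Visser
arXiv:0706.0622, (35) (the Kerr–Schild radius).  No named facts; no definitions.
-/

-- the doubled `FinalStateConjecture.FinalStateConjecture` path component trips dupNamespace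
set_option linter.dupNamespace false

noncomputable section

namespace Summit.FinalStateConjecture.FinalStateConjecture.Theorems.BartnikGapSettling.Capture.HypRadius

open Set Filter Topology
open scoped Manifold ContDiff ENNReal
open Literature.Geometry.Lorentzian
open Summit.FinalStateConjecture.FinalStateConjecture.Theorems (lorentz_apply_zero_sq)
open Summit.FinalStateConjecture.FinalStateConjecture.Theorems.BartnikGapSettling.Capture.PhantomSucc
  (stub_phantomSuccTube abs_apply_zero_le_norm_and_spatialNorm_le_norm)

/-- `|c̲ + s ũ| ≤ |c̲| + |s| |ũ|` (triangle inequality in `E3`). [folklore] -/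
private theorem spatialNorm_add_smul_le (c u : E4) (s : ℝ) :
    E4.spatialNorm (c + s • u) ≤ E4.spatialNorm c + |s| * E4.spatialNorm u := by
  unfold E4.spatialNorm
  rw [map_add, map_smul]
  exact (norm_add_le _ _).trans_eq (by rw [norm_smul, Real.norm_eq_abs])

/-- `1 ≤ √(1 + X²)`. [folklore] -/
private theorem one_le_sqrt_one_add_sq (X : ℝ) : 1 ≤ Real.sqrt (1 + X ^ 2) := by
  have h : Real.sqrt 1 ≤ Real.sqrt (1 + X ^ 2) := Real.sqrt_le_sqrt (by nlinarith [sq_nonneg X])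
  rwa [Real.sqrt_one] at h

/-- `√(1 + X²) ≤ 1 + X` for `X ≥ 0`. [folklore] -/
private theorem sqrt_one_add_sq_le {X : ℝ} (hX : 0 ≤ X) : Real.sqrt (1 + X ^ 2) ≤ 1 + X := by
  calc Real.sqrt (1 + X ^ 2) ≤ Real.sqrt ((1 + X) ^ 2) := Real.sqrt_le_sqrt (by nlinarith)
    _ = 1 + X := Real.sqrt_sq (by positivity)

/-- The spatial part of `e₀` vanishes. [folklore] -/
private theorem spatial_basisVector_zero : E4.spatial (E4.basisVector 0) = 0 := by
  ext i
  simp [E4.spatial_apply, Fin.succ_ne_zero]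

/-- **Every straight time-like world-line `s ↦ c + s Λe₀` crosses the unit hyperboloid
`{x⁰ − √(1 + |x̲|²) = 0}`**: the hyperboloidal time is continuous along the line and runs from
`−∞` to `+∞` because `((Λe₀)⁰)² = 1 + |(Λe₀)~|²` (O'Neill 1983, Ch. 9, p. 233). [folklore] -/
theorem exists_worldline_hypTime_eq_zero (Λ : lorentzGroup) (c : E4) :
    ∃ s : ℝ, (c + s • (Λ : E4 ≃L[ℝ] E4) (E4.basisVector 0)) 0 -
      Real.sqrt (1 + E4.spatialNorm (c + s • (Λ : E4 ≃L[ℝ] E4) (E4.basisVector 0)) ^ 2) = 0 := by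
  set u : E4 := (Λ : E4 ≃L[ℝ] E4) (E4.basisVector 0) with hu
  set γ : ℝ := u 0 with hγ
  set σ : ℝ := E4.spatialNorm u with hσ
  have hγσ : γ ^ 2 = 1 + σ ^ 2 := lorentz_apply_zero_sq Λ
  have hσ0 : 0 ≤ σ := E4.spatialNorm_nonneg u
  have hγ1 : 1 ≤ γ ^ 2 := by nlinarith [sq_nonneg σ]
  -- `2 (γ² − |γ| σ) ≥ 1`, i.e. `(|γ| − σ)² ≥ 0`
  have hkey : 1 ≤ 2 * (γ ^ 2 - |γ| * σ) := by nlinarith [sq_nonneg (|γ| - σ), sq_abs γ]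
  -- the hyperboloidal time along the line and its two-sided bounds
  set φ : ℝ → ℝ := fun s ↦ (c + s • u) 0 - Real.sqrt (1 + E4.spatialNorm (c + s • u) ^ 2)
    with hφ
  have hφc : Continuous φ := by
    have h1 : Continuous fun s : ℝ ↦ E4.spatialNorm (c + s • u) :=
      (continuous_norm.comp E4.spatial.continuous).comp
        (by fun_prop : Continuous fun s : ℝ ↦ c + s • u)
    have h2 : Continuous fun s : ℝ ↦ (c + s • u) 0 :=
      (EuclideanSpace.proj (0 : Fin 4)).continuous.comp (by fun_prop : Continuous fun s : ℝ ↦ c + s • u)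
    exact h2.sub (Real.continuous_sqrt.comp (continuous_const.add (h1.pow 2)))
  have hval : ∀ s, (c + s • u) 0 = c 0 + s * γ := fun s ↦ by simp [hγ]
  have hup : ∀ s, φ s ≤ c 0 + s * γ - 1 := fun s ↦ by
    simp only [hφ]
    rw [hval]
    linarith [one_le_sqrt_one_add_sq (E4.spatialNorm (c + s • u))]
  have hlow : ∀ s, c 0 + s * γ - 1 - E4.spatialNorm c - |s| * σ ≤ φ s := fun s ↦ by
    simp only [hφ]
    rw [hval]
    have h1 := sqrt_one_add_sq_le (E4.spatialNorm_nonneg (c + s • u))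
    have h2 := spatialNorm_add_smul_le c u s
    linarith
  have hc0 := E4.spatialNorm_nonneg c
  -- the late end `s₊ = T γ`
  set T : ℝ := 2 * (|c 0| + E4.spatialNorm c + 1) with hT
  have hT0 : 0 ≤ T := by positivity
  have hplus : 0 ≤ φ (T * γ) := by
    have h := hlow (T * γ)
    have h1 : |T * γ| = T * |γ| := by rw [abs_mul, abs_of_nonneg hT0]
    rw [h1] at h
    have h3 : T / 2 ≤ T * (γ ^ 2 - |γ| * σ) := by nlinarith
    have h4 : c 0 + T * γ * γ - 1 - E4.spatialNorm c - T * |γ| * σ =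
        c 0 - 1 - E4.spatialNorm c + T * (γ ^ 2 - |γ| * σ) := by ring
    rw [h4] at h
    have h5 : -|c 0| ≤ c 0 := neg_abs_le _
    linarith
  -- the early end `s₋ = −(|c⁰| + 2) γ`
  have hminus : φ (-(|c 0| + 2) * γ) ≤ 0 := by
    have h := hup (-(|c 0| + 2) * γ)
    have h1 : c 0 + -(|c 0| + 2) * γ * γ - 1 = c 0 - (|c 0| + 2) * γ ^ 2 - 1 := by ring
    rw [h1] at h
    have h2 : (|c 0| + 2) * 1 ≤ (|c 0| + 2) * γ ^ 2 :=
      mul_le_mul_of_nonneg_left hγ1 (by positivity)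
    linarith [le_abs_self (c 0)]
  -- intermediate value theorem on `ℝ`
  obtain ⟨s, hs⟩ := intermediate_value_univ (-(|c 0| + 2) * γ) (T * γ) hφc ⟨hminus, hplus⟩
  exact ⟨s, hs⟩

/-- On its own world-line the boosted Kerr–Schild radius vanishes:
`r_a(Λ⁻¹((c + s Λe₀) − c)) = r_a(s e₀) = 0` (Visser arXiv:0706.0622, (35): `r = 0` at the spatial
origin). [folklore] -/
theorem radius_poincareInv_worldline (Λ : lorentzGroup) (c : E4) (a s : ℝ) :
    Kerr.radius a (poincareInv Λ c (c + s • (Λ : E4 ≃L[ℝ] E4) (E4.basisVector 0))) = 0 := by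
  have h1 : poincareInv Λ c (c + s • (Λ : E4 ≃L[ℝ] E4) (E4.basisVector 0)) =
      s • E4.basisVector 0 := by
    rw [poincareInv, add_sub_cancel_left, map_smul, ContinuousLinearEquiv.symm_apply_apply]
  have h2 : E4.spatialNorm (s • E4.basisVector 0) = 0 := by
    rw [E4.spatialNorm, map_smul, spatial_basisVector_zero, smul_zero, norm_zero]
  have h3 : (s • E4.basisVector 0 : E4) 3 = 0 := by simp
  rw [h1, Kerr.radius, h2, h3]
  have h4 : Real.sqrt (((0 : ℝ) ^ 2 - a ^ 2) ^ 2 + 4 * a ^ 2 * (0 : ℝ) ^ 2) = a ^ 2 := by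
    rw [show ((0 : ℝ) ^ 2 - a ^ 2) ^ 2 + 4 * a ^ 2 * (0 : ℝ) ^ 2 = (a ^ 2) ^ 2 by ring]
    exact Real.sqrt_sq (sq_nonneg a)
  rw [h4]
  norm_num

/-- Far out on the unit hyperboloid the boosted Kerr–Schild radius is large (bounded tube
sections, `stub_phantomSuccTube`, p110726; the hyperboloid contains `(√(1 + L²), L, 0, 0)`).
[folklore] -/
theorem exists_hyp_radius_gt (Λ : lorentzGroup) (c : E4) (a t : ℝ) :
    ∃ x : E4, x 0 - Real.sqrt (1 + E4.spatialNorm x ^ 2) = 0 ∧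
      t < Kerr.radius a (poincareInv Λ c x) := by
  obtain ⟨D, hD⟩ := stub_phantomSuccTube Λ c a t
  set Lr : ℝ := max D 0 + 1 with hL
  have hL0 : 0 ≤ Lr := by rw [hL]; positivity
  set x : E4 := E4.ofTimeSpace (Real.sqrt (1 + Lr ^ 2)) (EuclideanSpace.single (0 : Fin 3) Lr)
    with hx
  have hx0 : x 0 = Real.sqrt (1 + Lr ^ 2) := E4.ofTimeSpace_apply_zero _ _
  have hxs : E4.spatialNorm x = Lr := by
    rw [hx, E4.spatialNorm_ofTimeSpace, PiLp.norm_single, Real.norm_eq_abs,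
      abs_of_nonneg hL0]
  have ht0 : x 0 - Real.sqrt (1 + E4.spatialNorm x ^ 2) = 0 := by rw [hx0, hxs, sub_self]
  refine ⟨x, ht0, lt_of_not_ge fun hle ↦ ?_⟩
  have hb := hD x hle (by rw [ht0]; norm_num) (by rw [ht0]; norm_num)
  have h1 : |x 0| ≤ ‖x‖ := (abs_apply_zero_le_norm_and_spatialNorm_le_norm x).1
  have h2 : Lr < Real.sqrt (1 + Lr ^ 2) := by
    calc Lr = Real.sqrt (Lr ^ 2) := (Real.sqrt_sq hL0).symm
      _ < Real.sqrt (1 + Lr ^ 2) := Real.sqrt_lt_sqrt (sq_nonneg _) (by linarith)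
  have h3 : D < Lr := by
    have := le_max_left D 0
    rw [hL]
    linarith
  rw [hx0, abs_of_nonneg (Real.sqrt_nonneg _)] at h1
  linarith

/-- **Registered stub `stub_hypRadius` (line `Sketch`, skeleton v7 §7b): every boosted
Kerr–Schild radius is attained on the unit hyperboloid.**  For every motion `(Λ, c)`, spin `a` and
`t > 0` there is a point `x` with `x⁰ − √(1 + |x̲|²) = 0` and `r_a(Λ⁻¹(x − c)) = t`: intermediate
value theorem on the connected `E4` for `x ↦ r_a(Λ⁻¹(π(x) − c))`, `π(x) = x + (√(1+|x̲|²) − x⁰) e₀`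
the vertical projection onto the hyperboloid, between the world-line's crossing point (`r = 0`,
`exists_worldline_hypTime_eq_zero`, `radius_poincareInv_worldline`) and a far point (`r > t`,
`exists_hyp_radius_gt`).  O'Neill 1983, Ch. 9, p. 233; Visser arXiv:0706.0622, (35). [folklore] -/
theorem stub_hypRadius :
    ∀ (Λ : lorentzGroup) (c : E4) (a t : ℝ), 0 < t →
      ∃ x : E4, x 0 - Real.sqrt (1 + E4.spatialNorm x ^ 2) = 0 ∧
        Kerr.radius a (poincareInv Λ c x) = t := by
  intro Λ c a t ht
  -- the vertical projection onto the hyperboloid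
  set π : E4 → E4 := fun x ↦ x + (Real.sqrt (1 + E4.spatialNorm x ^ 2) - x 0) • E4.basisVector 0
    with hπ
  have hπ0 : ∀ x, π x 0 = Real.sqrt (1 + E4.spatialNorm x ^ 2) := fun x ↦ by simp [hπ]
  have hπs : ∀ x, E4.spatialNorm (π x) = E4.spatialNorm x := fun x ↦ by
    simp only [hπ]
    rw [E4.spatialNorm, E4.spatialNorm, map_add, map_smul, spatial_basisVector_zero, smul_zero,
      add_zero]
  have hπt : ∀ x, π x 0 - Real.sqrt (1 + E4.spatialNorm (π x) ^ 2) = 0 := fun x ↦ by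
    rw [hπ0, hπs, sub_self]
  have hπfix : ∀ x : E4, x 0 - Real.sqrt (1 + E4.spatialNorm x ^ 2) = 0 → π x = x := fun x h ↦ by
    simp only [hπ]
    rw [show Real.sqrt (1 + E4.spatialNorm x ^ 2) - x 0 = 0 by linarith, zero_smul, add_zero]
  have hπc : Continuous π := by
    have h1 : Continuous fun x : E4 ↦ Real.sqrt (1 + E4.spatialNorm x ^ 2) - x 0 :=
      (Real.continuous_sqrt.comp (continuous_const.add
        ((continuous_norm.comp E4.spatial.continuous).pow 2))).sub
        (EuclideanSpace.proj (0 : Fin 4)).continuous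
    exact continuous_id.add (h1.smul continuous_const)
  -- IVT on `E4`
  set f : E4 → ℝ := fun x ↦ Kerr.radius a (poincareInv Λ c (π x)) with hf
  have hfc : Continuous f :=
    (Kerr.continuous_radius a).comp ((continuous_poincareInv Λ c).comp hπc)
  obtain ⟨s, hs⟩ := exists_worldline_hypTime_eq_zero Λ c
  obtain ⟨xf, hxf, htf⟩ := exists_hyp_radius_gt Λ c a t
  have hfn : f (c + s • (Λ : E4 ≃L[ℝ] E4) (E4.basisVector 0)) = 0 := by
    simp only [hf]
    rw [hπfix _ hs]
    exact radius_poincareInv_worldline Λ c a s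
  have hff : t < f xf := by
    simp only [hf]
    rwa [hπfix _ hxf]
  obtain ⟨x, hx⟩ := intermediate_value_univ (c + s • (Λ : E4 ≃L[ℝ] E4) (E4.basisVector 0)) xf hfc
    ⟨by rw [hfn]; exact ht.le, hff.le⟩
  exact ⟨π x, hπt x, hx⟩

end Summit.FinalStateConjecture.FinalStateConjecture.Theorems.BartnikGapSettling.Capture.HypRadius

end
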